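import Literature.AlgebraicGeometry.Deformation.SmoothLiftObstructionClassAtlasGluingsQuot
import Literature.AlgebraicGeometry.Deformation.SmoothLiftChartChangeQuot
import HarnessLib

/-!
# The κ-class at the atlas does not depend on the chart lifts — QUOTIENT CURRENCY
# (Hartshorne, *Deformation Theory*, proof of Thm. 10.2 (a), Cor. 10.3 (a); [Oort1971] Lemma (2.2.4), §2.2)

Layer `Literature/AlgebraicGeometry/Deformation`, namespace `Literature.AlgebraicGeometry.Deformation.AtlasChartChangeQuot`.
PROOF FILE, THEOREMS ONLY (no definition, no instance, no notation, no named fact, no `sorry`).  Head (vii-f) «CHART-LIFT INDEPENDENCE» of the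
κ-class canonicity package of the (U-glob) organ (cell `hodgecm-mathlib`, P6 sub-desk P6b, deal 2026-09-02T20:29:07Z; count-neutral ★ capital on
`--supports stmt-HodgeConjecture-24832`).  Seams: (vii-d) transport along an isomorphism of the scheme being lifted, (vii-e) refinement of the
cover; THIS file: the SAME principal affine cover `V`, the SAME closed-fibre layer `π`, two families of local lifts.

THE PRINT.  [Oort1971, Lemma (2.2.4), p. 274]: «… the lift is unique locally up to a (non-canonical) isomorphism»; [Oort1971, §2.2, pp. 277–280]:
`D(X′; R → R′)` «does not depend on the choices made».  [Hartshorne2010, Thm. 10.2 (a), proof, p. 81]: «For each `i` let `U'_i` be an extension of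
`U_i` over `C'` … so we get an obstruction `δ₃ ∈ H²(X₀, T⁰_{X₀} ⊗ J)`», and [Cor. 10.3 (a), p. 82]: «There is just one obstruction in `H²(X₀, 𝒯_{X₀} ⊗ J)`»
([Remark 10.2.2, p. 82] = the readings' currency: automorphisms of an extension over the identity `≅ H⁰(X₀, T⁰_{X₀} ⊗ J)`).  The half of well-definedness
about the GLUINGS is ★ `LiftObstructionClassAtlasQuot.cechMH2_mk_eq_of_gluings`; the half about the LOCAL LIFTS `U'_i` is this file: over the ★
INDEXED-ATLAS VOCABULARY (`chartLift`, `gluingOn`, `disc`, `readingAut`, abstract closed-fibre layer `(B, π, hπ)`), for TWO chart families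
`(P, r)` and `(P', r')` of the same principal affine cover `(V, c)` —

* §1 CHART CHANGES ON THE ATLAS (f1).  [Oort1971] (2.2.4) at LEVEL 0 (★ (U-sup) `exists_gluing` between the chart lifts `L(r' a, res_{V a})` and
  `L(r a, res_{V a})`, the one formally smooth, the other flat; `V a = D(c a a)`), then RESTRICTED to every principal open `W ⊆ V a` of the chart by
  ★ (U-can) II `gluingRestrict`: ONE family `Θ a W : chartLift V r' a _ ≃ₐ[A'] chartLift V r a _`, compatible with the canonical reductions and
  NATURAL under the canonical restrictions (`exists_chartChanges`) — characterised by these two properties, never constructed as data.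
* §2 TRANSPORTED GLUINGS.  Along `Θ` a gluing system `ψ'` of the second charts transports to `χ a b = (Θ a)⁻¹ ≫ ψ' a b ≫ Θ b` on the first
  charts, CHARACTERISED by the square `Θ b (ψ' a b x) = χ a b (Θ a x)` (★ (x) `transport_intertwine`); `χ` is again reduction-compatible
  (`transport_reduction`, ★ (x) `transport_compat`), and the restricted gluings `gluingOn ψ'`, `gluingOn χ` on a deeper principal open are
  intertwined by the `Θ`'s there (`chartChange_gluingOn`: ★ `gluingOn_restrict`, naturality, ★ `algHom_ext_restrict`).
* §3 THE READINGS DO NOT MOVE (f2).  If `θ_δ = disc ψ' a b d` on the second chart then `θ_δ = disc χ a b d` on the first chart — the SAME face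
  reading `δ` on the nose, no coboundary (`readingAut_eq_disc_of_chartChanges`: ★ (x) `reading_transport`, i.e. conjugate automorphisms of two flat
  lifts with identified closed fibres `fibreRed r a ∘ Θ a = fibreRed r' a` have the same reading); packaged with §1–§2 as
  `exists_gluings_readingAut_eq_disc`.
* §4 THE κ-CLASS DOES NOT DEPEND ON THE CHARTS (f3).  On the κ-side closed-fibre layer of ★ (vii-b) (`X`, `i`, `π`, `hπnat`, `φ`): two data
  `(P, r, ψ, δ, o)` and `(P', r', ψ', δ', o')` over one `(V, c, π)` have `[o'] = [o]` in `Ȟ²(i⁻¹𝒱; 𝒯_{X/κ})` (`cechMH2_mk_eq_of_chartChange`) — §1–§3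
  hand `δ'` over as face readings of the transported gluings `χ` of the FIRST charts, and ★ (vii-b) C `cechMH2_mk_eq_of_gluings` compares `ψ`
  with `χ`.  So the class depends on the cover only; with (vii-d)∕(vii-e) and ★ `CechModuleH2RefinementInjective` it depends on nothing.

ED. 2 = ED. 1 (p852693) with the choice-independence gloss re-pointed from Remark 10.2.2 to Cor. 10.3 (a) (lit2 RULING (995)); decls byte-identical.
HC_CM is proved only modulo the printed citations until rung 0 closes; nothing here bears on a summit statement.

## References
* [Hartshorne2010] R. Hartshorne, *Deformation Theory*, GTM 257 (2010): Thm. 10.2 (a) and its proof (p. 81), Remark 10.2.2, Cor. 10.3 (a) (p. 82).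
* [Oort1971] F. Oort, *Finite group schemes, local moduli for abelian varieties, and lifting problems*, Compositio Math. 23 (1971),
  Lemma (2.2.4) (p. 274), §2.2 (pp. 277–280).
* [StacksProject] The Stacks Project, Tag 00CP (maps out of a localisation).
-/

noncomputable section

-- `TopCat.Presheaf`/`TopCat.Sheaf` are not reducible (as in Mathlib's `AlgebraicGeometry/Modules`).
set_option backward.isDefEq.respectTransparency false

open CategoryTheory AlgebraicGeometry Opposite TopologicalSpace
open scoped TensorProduct

universe u

namespace Literature.AlgebraicGeometry.Deformation.AtlasChartChangeQuot

open Literature.AlgebraicGeometry.HodgeTheory Literature.AlgebraicGeometry.Modules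
  Literature.AlgebraicGeometry.Motives Literature.AlgebraicGeometry.Morphisms
  Literature.AlgebraicGeometry.Deformation.LiftObstructionCechClassQuot
  Literature.AlgebraicGeometry.Deformation.AtlasQuot Literature.AlgebraicGeometry.Deformation.CanonicalLiftQuot
  Literature.AlgebraicGeometry.Deformation.ExtensionAutomorphisms Literature.AlgebraicGeometry.Deformation.ExtensionAutomorphismsQuot
  Literature.AlgebraicGeometry.Deformation.LiftObstructionCocycleQuot Literature.AlgebraicGeometry.Deformation.LiftGluingSuppliersQuot
  Literature.AlgebraicGeometry.Deformation.LiftChartChangeQuot Literature.AlgebraicGeometry.Deformation.LiftObstructionClassAtlasQuot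

variable {A' : Type u} [CommRing A'] (J : Ideal A')
  {X₀ : Scheme.{u}} [instΓ₀ : ∀ W : X₀.Opens, Algebra A' Γ(X₀, W)]
  (halg₀ : ∀ (W W' : X₀.Opens) (e : W' ≤ W) (a : A'), X₀.presheaf.map (homOfLE e).op (algebraMap A' Γ(X₀, W) a) = algebraMap A' Γ(X₀, W') a)
  (hJ : IsNilpotent J) {ι : Type u} (V : ι → X₀.affineOpens) (c : (a b : ι) → Γ(X₀, (V a).1))
  (hc : ∀ a b, (V a).1 ⊓ (V b).1 = X₀.basicOpen (c a b))
  -- the FIRST charts `(P, r)`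
  {P : ι → Type u} [∀ a, CommRing (P a)] [∀ a, Algebra A' (P a)]
  (r : (a : ι) → P a →ₐ[A'] Γ(X₀, (V a).1)) (hr : ∀ a, Function.Surjective (r a))
  (hkr : ∀ a, RingHom.ker (r a) = J.map (algebraMap A' (P a)))
  -- the SECOND charts `(P', r')` of the SAME cover
  {P' : ι → Type u} [∀ a, CommRing (P' a)] [∀ a, Algebra A' (P' a)]
  (r' : (a : ι) → P' a →ₐ[A'] Γ(X₀, (V a).1)) (hr' : ∀ a, Function.Surjective (r' a))
  (hkr' : ∀ a, RingHom.ker (r' a) = J.map (algebraMap A' (P' a)))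

/-! ## §1 (f1) Chart changes on the indexed atlas: level 0, then every principal open of the chart -/

omit instΓ₀ in
include hc in
/-- Every chart of a principal affine cover is principal in itself: `V a = D(c a a)`. [cite: StacksProject, Tag 00CP]
[cite: Hartshorne2010, Thm. 10.2 (a) (proof), p. 81] -/
theorem exists_self_eq_basicOpen (a : ι) : ∃ q : Γ(X₀, (V a).1), (V a).1 = X₀.basicOpen q :=
  ⟨c a a, by rw [← hc a a, inf_idem]⟩

omit instΓ₀ in
include hc in
/-- The pair overlap is principal on the SECOND chart too: `V a ⊓ V b = D(c b a)`. [cite: StacksProject, Tag 00CP]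
[cite: Hartshorne2010, Thm. 10.2 (a) (proof), p. 81] -/
theorem exists_inf_eq_basicOpen₂ (a b : ι) : ∃ q : Γ(X₀, (V b).1), (V a).1 ⊓ (V b).1 = X₀.basicOpen q :=
  ⟨c b a, by rw [← hc b a]; exact inf_comm _ _⟩

include hJ hr hkr hr' hkr' hc in
/-- **LEVEL-0 CHART CHANGES EXIST** ([Oort1971] (2.2.4) «the lift is unique locally up to a (non-canonical) isomorphism»): for the second chart
formally smooth and the first chart flat over `A'`, there is `Θ₀ : L(r' a, res_{V a}) ≃ₐ[A'] L(r a, res_{V a})` compatible with the canonical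
reductions onto `Γ(X₀, V a)` — LITERALLY ★ (U-sup) `exists_gluing` at the chart lifts (★ (U-can) `formallySmooth`, `flat`, `reduction_surjective`,
`ker_reduction`; `V a = D(c a a)`). [cite: Oort1971, Lemma (2.2.4) (p. 274)] [cite: Hartshorne2010, Thm. 10.2 (a) (proof), p. 81] -/
theorem exists_chartChange₀ [∀ a, Algebra.FormallySmooth A' (P' a)] [∀ a, Module.Flat A' (P a)] (a : ι) :
    ∃ Θ₀ : chartLift V r' a (le_rfl : (V a).1 ≤ (V a).1) ≃ₐ[A'] chartLift V r a (le_rfl : (V a).1 ≤ (V a).1),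
      ∀ x, reduction (r a) (AtlasQuot.res (le_rfl : (V a).1 ≤ (V a).1)) (halg₀ _ _ _) (Θ₀ x) =
        reduction (r' a) (AtlasQuot.res (le_rfl : (V a).1 ≤ (V a).1)) (halg₀ _ _ _) x := by
  haveI := CanonicalLiftQuot.formallySmooth (r' a) (AtlasQuot.res (le_rfl : (V a).1 ≤ (V a).1))
  haveI := CanonicalLiftQuot.flat (r a) (AtlasQuot.res (le_rfl : (V a).1 ≤ (V a).1))
  obtain ⟨q, hq⟩ := exists_self_eq_basicOpen V c hc a
  exact exists_gluing hJ _
    (reduction_surjective hJ (r' a) (hr' a) (hkr' a) _ (halg₀ _ _ _) ((V a).2.isLocalization_of_eq_basicOpen q (homOfLE le_rfl) hq))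
    (ker_reduction hJ (r' a) (hr' a) (hkr' a) _ (halg₀ _ _ _) ((V a).2.isLocalization_of_eq_basicOpen q (homOfLE le_rfl) hq)) _
    (reduction_surjective hJ (r a) (hr a) (hkr a) _ (halg₀ _ _ _) ((V a).2.isLocalization_of_eq_basicOpen q (homOfLE le_rfl) hq))
    (ker_reduction hJ (r a) (hr a) (hkr a) _ (halg₀ _ _ _) ((V a).2.isLocalization_of_eq_basicOpen q (homOfLE le_rfl) hq))

/-- **RESTRICTED GLUINGS ARE NATURAL IN THE DEEPER OPEN** (ring level, ★ (U-can) II letters): for a reduction-compatible gluing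
`ψ : L(r₁, g₁) ≃ L(r₂, g₂)` and two deeper opens `O′`, `O″` with `O″` below `O′` (`gᵢ″ = k″ ∘ gᵢ′`), restricting `ψ` to `O″` after the canonical
restriction `L(rᵢ, gᵢ′) → L(rᵢ, gᵢ″)` is the canonical restriction of `ψ` restricted to `O′` — both are algebra maps out of the localisation
`L(r₁, g₁′)` of `L(r₁, g₁)` agreeing there (★ `gluingRestrict_restrict`, `restrict_restrict`, `algHom_ext_restrict`): the `L`'s and the restricted
gluings form a genuine morphism of presheaves on the principal opens. [cite: Hartshorne2010, Thm. 10.2 (a) (proof), p. 81] [cite: StacksProject, Tag 00CP] -/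
theorem restrict_gluingRestrict {P₁ : Type u} [CommRing P₁] [Algebra A' P₁] {P₂ : Type u} [CommRing P₂] [Algebra A' P₂]
    {Q₁ : Type u} [CommRing Q₁] [Algebra A' Q₁] {Q₂ : Type u} [CommRing Q₂] [Algebra A' Q₂]
    {O : Type u} [CommRing O] [Algebra A' O] {O' : Type u} [CommRing O'] [Algebra A' O'] {O'' : Type u} [CommRing O''] [Algebra A' O'']
    (r₁ : P₁ →ₐ[A'] Q₁) (hr₁ : Function.Surjective r₁) (hkr₁ : RingHom.ker r₁ = J.map (algebraMap A' P₁))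
    (r₂ : P₂ →ₐ[A'] Q₂) (hr₂ : Function.Surjective r₂) (hkr₂ : RingHom.ker r₂ = J.map (algebraMap A' P₂))
    (g₁ : Q₁ →+* O) (hg₁ : ∀ a, g₁ (algebraMap A' Q₁ a) = algebraMap A' O a)
    (g₂ : Q₂ →+* O) (hg₂ : ∀ a, g₂ (algebraMap A' Q₂ a) = algebraMap A' O a)
    (g₁' : Q₁ →+* O') (hg₁' : ∀ a, g₁' (algebraMap A' Q₁ a) = algebraMap A' O' a)
    (g₂' : Q₂ →+* O') (hg₂' : ∀ a, g₂' (algebraMap A' Q₂ a) = algebraMap A' O' a)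
    (k : O →+* O') (hk₁ : ∀ q, g₁' q = k (g₁ q)) (hk₂ : ∀ q, g₂' q = k (g₂ q))
    (hO'₁ : ∃ q : Q₁, @IsLocalization.Away Q₁ _ q O' _ g₁'.toAlgebra) (hO'₂ : ∃ q : Q₂, @IsLocalization.Away Q₂ _ q O' _ g₂'.toAlgebra)
    (g₁'' : Q₁ →+* O'') (hg₁'' : ∀ a, g₁'' (algebraMap A' Q₁ a) = algebraMap A' O'' a)
    (g₂'' : Q₂ →+* O'') (hg₂'' : ∀ a, g₂'' (algebraMap A' Q₂ a) = algebraMap A' O'' a)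
    (k' : O →+* O'') (hk'₁ : ∀ q, g₁'' q = k' (g₁ q)) (hk'₂ : ∀ q, g₂'' q = k' (g₂ q))
    (hO''₁ : ∃ q : Q₁, @IsLocalization.Away Q₁ _ q O'' _ g₁''.toAlgebra) (hO''₂ : ∃ q : Q₂, @IsLocalization.Away Q₂ _ q O'' _ g₂''.toAlgebra)
    (k'' : O' →+* O'') (hk''₁ : ∀ q, g₁'' q = k'' (g₁' q)) (hk''₂ : ∀ q, g₂'' q = k'' (g₂' q))
    (ψ : CanonicalLift r₁ g₁ ≃ₐ[A'] CanonicalLift r₂ g₂) (hψ : ∀ x, reduction r₂ g₂ hg₂ (ψ x) = reduction r₁ g₁ hg₁ x)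
    (y : CanonicalLift r₁ g₁') :
    gluingRestrict hJ r₁ hr₁ hkr₁ r₂ hr₂ hkr₂ g₁ hg₁ g₂ hg₂ g₁'' hg₁'' g₂'' hg₂'' k' hk'₁ hk'₂ hO''₁ hO''₂ ψ hψ
        (restrict r₁ g₁' g₁'' (liftSubmonoid_mono r₁ g₁' g₁'' k'' hk''₁) y) =
      restrict r₂ g₂' g₂'' (liftSubmonoid_mono r₂ g₂' g₂'' k'' hk''₂)
        (gluingRestrict hJ r₁ hr₁ hkr₁ r₂ hr₂ hkr₂ g₁ hg₁ g₂ hg₂ g₁' hg₁' g₂' hg₂' k hk₁ hk₂ hO'₁ hO'₂ ψ hψ y) := by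
  have key := algHom_ext_restrict r₁ g₁ g₁' (liftSubmonoid_mono r₁ g₁ g₁' k hk₁)
    ((gluingRestrict hJ r₁ hr₁ hkr₁ r₂ hr₂ hkr₂ g₁ hg₁ g₂ hg₂ g₁'' hg₁'' g₂'' hg₂'' k' hk'₁ hk'₂ hO''₁ hO''₂ ψ hψ : _ →ₐ[A'] _).comp
      (restrict r₁ g₁' g₁'' (liftSubmonoid_mono r₁ g₁' g₁'' k'' hk''₁)))
    ((restrict r₂ g₂' g₂'' (liftSubmonoid_mono r₂ g₂' g₂'' k'' hk''₂)).comp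
      (gluingRestrict hJ r₁ hr₁ hkr₁ r₂ hr₂ hkr₂ g₁ hg₁ g₂ hg₂ g₁' hg₁' g₂' hg₂' k hk₁ hk₂ hO'₁ hO'₂ ψ hψ : _ →ₐ[A'] _))
    fun z => by
      simp only [AlgHom.comp_apply, AlgEquiv.coe_toAlgHom]
      rw [restrict_restrict, gluingRestrict_restrict, gluingRestrict_restrict, restrict_restrict]
  exact congrArg (fun f : _ →ₐ[A'] _ => f y) key

include hJ hr hkr hr' hkr' hc in
/-- **THE CHART CHANGES ON ALL PRINCIPAL OPENS OF THE CHARTS (f1).**  For the second charts formally smooth and the first charts flat, there is ONE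
family `Θ a W : chartLift V r' a _ ≃ₐ[A'] chartLift V r a _` (`W ⊆ V a` principal) (i) compatible with the canonical reductions onto `Γ(X₀, W)` and
(ii) NATURAL under the canonical restrictions `W′ ⊆ W` (`Θ (y|) = (Θ y)|`) — the level-0 chart changes (`exists_chartChange₀`) restricted by ★ (U-can)
II `gluingRestrict` (`reduction_gluingRestrict`; naturality by `gluingRestrict_restrict`, `restrict_restrict` and extensionality out of the
localisation ★ `algHom_ext_restrict`).  Everything below takes such a family as HYPOTHESES `(Θ, hΘred, hΘnat)`.
[cite: Oort1971, Lemma (2.2.4) (p. 274)] [cite: Hartshorne2010, Thm. 10.2 (a) (proof), p. 81] [cite: StacksProject, Tag 00CP] -/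
theorem exists_chartChanges [∀ a, Algebra.FormallySmooth A' (P' a)] [∀ a, Module.Flat A' (P a)] :
    ∃ Θ : ∀ (a : ι) (W : X₀.Opens) (h : W ≤ (V a).1) (_ : ∃ q : Γ(X₀, (V a).1), W = X₀.basicOpen q),
        chartLift V r' a h ≃ₐ[A'] chartLift V r a h,
      (∀ (a : ι) (W : X₀.Opens) (h : W ≤ (V a).1) (pa : ∃ q : Γ(X₀, (V a).1), W = X₀.basicOpen q) (x : chartLift V r' a h),
        reduction (r a) (AtlasQuot.res h) (halg₀ _ _ _) (Θ a W h pa x) = reduction (r' a) (AtlasQuot.res h) (halg₀ _ _ _) x) ∧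
      (∀ (a : ι) (W W' : X₀.Opens) (h : W ≤ (V a).1) (h' : W' ≤ (V a).1) (hW'W : W' ≤ W)
        (pa : ∃ q : Γ(X₀, (V a).1), W = X₀.basicOpen q) (pa' : ∃ q : Γ(X₀, (V a).1), W' = X₀.basicOpen q) (y : chartLift V r' a h),
        Θ a W' h' pa' (restrict (r' a) (AtlasQuot.res h) (AtlasQuot.res h')
            (liftSubmonoid_mono _ _ _ (AtlasQuot.res hW'W) fun q => AtlasQuot.res_res h hW'W q) y) =
          restrict (r a) (AtlasQuot.res h) (AtlasQuot.res h')
            (liftSubmonoid_mono _ _ _ (AtlasQuot.res hW'W) fun q => AtlasQuot.res_res h hW'W q) (Θ a W h pa y)) := by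
  choose Θ₀ hΘ₀ using exists_chartChange₀ J halg₀ hJ V c hc r hr hkr r' hr' hkr'
  refine ⟨fun a W h pa => gluingRestrict hJ (r' a) (hr' a) (hkr' a) (r a) (hr a) (hkr a)
      (AtlasQuot.res (le_rfl : (V a).1 ≤ (V a).1)) (halg₀ _ _ _) (AtlasQuot.res (le_rfl : (V a).1 ≤ (V a).1)) (halg₀ _ _ _)
      (AtlasQuot.res h) (halg₀ _ _ _) (AtlasQuot.res h) (halg₀ _ _ _) (AtlasQuot.res h)
      (fun q => AtlasQuot.res_res le_rfl h q) (fun q => AtlasQuot.res_res le_rfl h q)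
      (pa.elim fun q hq => ⟨q, (V a).2.isLocalization_of_eq_basicOpen q (homOfLE h) hq⟩)
      (pa.elim fun q hq => ⟨q, (V a).2.isLocalization_of_eq_basicOpen q (homOfLE h) hq⟩) (Θ₀ a) (hΘ₀ a),
    fun a W h pa x => reduction_gluingRestrict hJ (r' a) (hr' a) (hkr' a) (r a) (hr a) (hkr a) _ _ _ _ _ _ _ _ _ _ _ _ _ (Θ₀ a) (hΘ₀ a) x,
    fun a W W' h h' hW'W pa pa' y => ?_⟩
  exact restrict_gluingRestrict J hJ (r' a) (hr' a) (hkr' a) (r a) (hr a) (hkr a) _ _ _ _ _ _ _ _ _ _ _ _ _ _ _ _ _ _ _ _ _ _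
    (AtlasQuot.res hW'W) (fun q => AtlasQuot.res_res h hW'W q) (fun q => AtlasQuot.res_res h hW'W q) (Θ₀ a) (hΘ₀ a) y

/-! ## §2 Transported gluings along the chart changes -/

section Transport

variable (Θ : ∀ (a : ι) (W : X₀.Opens) (h : W ≤ (V a).1) (_ : ∃ q : Γ(X₀, (V a).1), W = X₀.basicOpen q),
    chartLift V r' a h ≃ₐ[A'] chartLift V r a h)
  (hΘred : ∀ (a : ι) (W : X₀.Opens) (h : W ≤ (V a).1) (pa : ∃ q : Γ(X₀, (V a).1), W = X₀.basicOpen q) (x : chartLift V r' a h),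
    reduction (r a) (AtlasQuot.res h) (halg₀ _ _ _) (Θ a W h pa x) = reduction (r' a) (AtlasQuot.res h) (halg₀ _ _ _) x)
  (hΘnat : ∀ (a : ι) (W W' : X₀.Opens) (h : W ≤ (V a).1) (h' : W' ≤ (V a).1) (hW'W : W' ≤ W)
    (pa : ∃ q : Γ(X₀, (V a).1), W = X₀.basicOpen q) (pa' : ∃ q : Γ(X₀, (V a).1), W' = X₀.basicOpen q) (y : chartLift V r' a h),
    Θ a W' h' pa' (restrict (r' a) (AtlasQuot.res h) (AtlasQuot.res h')
        (liftSubmonoid_mono _ _ _ (AtlasQuot.res hW'W) fun q => AtlasQuot.res_res h hW'W q) y) =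
      restrict (r a) (AtlasQuot.res h) (AtlasQuot.res h')
        (liftSubmonoid_mono _ _ _ (AtlasQuot.res hW'W) fun q => AtlasQuot.res_res h hW'W q) (Θ a W h pa y))
  -- a gluing system of the SECOND charts
  (ψ' : (a b : ι) → chartLift V r' a (inf_le_left : (V a).1 ⊓ (V b).1 ≤ (V a).1) ≃ₐ[A']
    chartLift V r' b (inf_le_right : (V a).1 ⊓ (V b).1 ≤ (V b).1))
  (hψ' : ∀ a b x, reduction (r' b) (AtlasQuot.res (inf_le_right : (V a).1 ⊓ (V b).1 ≤ (V b).1)) (halg₀ _ _ _) (ψ' a b x) =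
    reduction (r' a) (AtlasQuot.res (inf_le_left : (V a).1 ⊓ (V b).1 ≤ (V a).1)) (halg₀ _ _ _) x)
  -- its transport to the FIRST charts, characterised by the intertwining square
  (χ : (a b : ι) → chartLift V r a (inf_le_left : (V a).1 ⊓ (V b).1 ≤ (V a).1) ≃ₐ[A']
    chartLift V r b (inf_le_right : (V a).1 ⊓ (V b).1 ≤ (V b).1))
  (hinter : ∀ a b x, Θ b ((V a).1 ⊓ (V b).1) inf_le_right (exists_inf_eq_basicOpen₂ V c hc a b) (ψ' a b x) =
    χ a b (Θ a ((V a).1 ⊓ (V b).1) inf_le_left ⟨c a b, hc a b⟩ x))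

include hc in
/-- **TRANSPORTED GLUINGS EXIST:** `χ a b := (Θ a)⁻¹ ≫ ψ' a b ≫ Θ b` on `V a ⊓ V b` satisfies the square `Θ b (ψ' a b x) = χ a b (Θ a x)`
(★ (x) `transport_intertwine`). [cite: Hartshorne2010, Thm. 10.2 (a) (proof), p. 81] -/
theorem exists_transportedGluings :
    ∃ χ : (a b : ι) → chartLift V r a (inf_le_left : (V a).1 ⊓ (V b).1 ≤ (V a).1) ≃ₐ[A']
        chartLift V r b (inf_le_right : (V a).1 ⊓ (V b).1 ≤ (V b).1),
      ∀ a b x, Θ b ((V a).1 ⊓ (V b).1) inf_le_right (exists_inf_eq_basicOpen₂ V c hc a b) (ψ' a b x) =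
        χ a b (Θ a ((V a).1 ⊓ (V b).1) inf_le_left ⟨c a b, hc a b⟩ x) :=
  ⟨fun a b => (Θ a ((V a).1 ⊓ (V b).1) inf_le_left ⟨c a b, hc a b⟩).symm.trans
      ((ψ' a b).trans (Θ b ((V a).1 ⊓ (V b).1) inf_le_right (exists_inf_eq_basicOpen₂ V c hc a b))),
    fun _ _ x => transport_intertwine _ _ _ x⟩

include hΘred hψ' hinter in
/-- **Transported gluings are reduction-compatible** (★ (x) `transport_compat` with the canonical reductions of the four chart lifts).
[cite: Hartshorne2010, Thm. 10.2 (a) (proof), p. 81] [cite: Oort1971, §2.2 (pp. 277–280)] -/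
theorem transport_reduction (a b : ι) (y : chartLift V r a (inf_le_left : (V a).1 ⊓ (V b).1 ≤ (V a).1)) :
    reduction (r b) (AtlasQuot.res (inf_le_right : (V a).1 ⊓ (V b).1 ≤ (V b).1)) (halg₀ _ _ _) (χ a b y) =
      reduction (r a) (AtlasQuot.res (inf_le_left : (V a).1 ⊓ (V b).1 ≤ (V a).1)) (halg₀ _ _ _) y :=
  transport_compat (reduction (r' a) (AtlasQuot.res (inf_le_left : (V a).1 ⊓ (V b).1 ≤ (V a).1)) (halg₀ _ _ _))
    (reduction (r' b) (AtlasQuot.res (inf_le_right : (V a).1 ⊓ (V b).1 ≤ (V b).1)) (halg₀ _ _ _))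
    (reduction (r a) (AtlasQuot.res (inf_le_left : (V a).1 ⊓ (V b).1 ≤ (V a).1)) (halg₀ _ _ _))
    (reduction (r b) (AtlasQuot.res (inf_le_right : (V a).1 ⊓ (V b).1 ≤ (V b).1)) (halg₀ _ _ _))
    (Θ a ((V a).1 ⊓ (V b).1) inf_le_left ⟨c a b, hc a b⟩) (Θ b ((V a).1 ⊓ (V b).1) inf_le_right (exists_inf_eq_basicOpen₂ V c hc a b))
    (ψ' a b) (χ a b) (hψ' a b) (hΘred a _ _ _) (hΘred b _ _ _) (hinter a b) y

include hΘnat hinter in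
/-- **THE CHART CHANGES INTERTWINE THE RESTRICTED GLUINGS** on every deeper principal open `W ⊆ V a ⊓ V b`:
`Θ b W (ψ'|_W x) = χ|_W (Θ a W x)` — both sides are algebra maps out of the localisation `L(r' a, res_W)` of `L(r' a, res_{V a ⊓ V b})` agreeing on
`V a ⊓ V b` (★ `gluingOn_restrict`, naturality `hΘnat`, the square `hinter`; ★ `algHom_ext_restrict`) — the hypothesis `c_{ij}` of ★ (x)
`reading_transport` on a face. [cite: Hartshorne2010, Thm. 10.2 (a) (proof), p. 81] [cite: StacksProject, Tag 00CP] -/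
theorem chartChange_gluingOn (a b : ι) (W : X₀.Opens) (ha : W ≤ (V a).1) (hb : W ≤ (V b).1)
    (pa : ∃ q : Γ(X₀, (V a).1), W = X₀.basicOpen q) (pb : ∃ q : Γ(X₀, (V b).1), W = X₀.basicOpen q) (x : chartLift V r' a ha) :
    Θ b W hb pb (gluingOn halg₀ hJ V r' hr' hkr' ψ' hψ' a b W ha hb pa pb x) =
      gluingOn halg₀ hJ V r hr hkr χ (transport_reduction halg₀ V c hc r r' Θ hΘred ψ' hψ' χ hinter) a b W ha hb pa pb (Θ a W ha pa x) := by
  have key : (Θ b W hb pb : chartLift V r' b hb →ₐ[A'] chartLift V r b hb).comp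
        (gluingOn halg₀ hJ V r' hr' hkr' ψ' hψ' a b W ha hb pa pb : chartLift V r' a ha →ₐ[A'] chartLift V r' b hb) =
      (gluingOn halg₀ hJ V r hr hkr χ (transport_reduction halg₀ V c hc r r' Θ hΘred ψ' hψ' χ hinter) a b W ha hb pa pb :
          chartLift V r a ha →ₐ[A'] chartLift V r b hb).comp (Θ a W ha pa : chartLift V r' a ha →ₐ[A'] chartLift V r a ha) := by
    refine algHom_ext_restrict (r' a) (AtlasQuot.res (inf_le_left : (V a).1 ⊓ (V b).1 ≤ (V a).1)) (AtlasQuot.res ha)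
      (liftSubmonoid_mono _ _ _ (AtlasQuot.res (le_inf ha hb)) fun q => AtlasQuot.res_res inf_le_left (le_inf ha hb) q) _ _ fun x => ?_
    simp only [AlgHom.comp_apply, AlgEquiv.coe_toAlgHom]
    rw [gluingOn_restrict, hΘnat b ((V a).1 ⊓ (V b).1) W inf_le_right hb (le_inf ha hb) (exists_inf_eq_basicOpen₂ V c hc a b) pb, hinter,
      hΘnat a ((V a).1 ⊓ (V b).1) W inf_le_left ha (le_inf ha hb) ⟨c a b, hc a b⟩ pa, gluingOn_restrict]
  exact congrArg (fun f : _ →ₐ[A'] _ => f x) key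

/-! ## §3 (f2) The face readings do not move under a chart change -/

variable (𝔪 : Ideal A') {B : X₀.Opens → Type u} [∀ W, CommRing (B W)] [∀ W, Algebra A' (B W)] (π : (W : X₀.Opens) → Γ(X₀, W) →ₐ[A'] B W)
  (hπ : ∀ (a : ι) (W : X₀.Opens), W ≤ (V a).1 → (∃ q : Γ(X₀, (V a).1), W = X₀.basicOpen q) →
    Function.Surjective (π W) ∧ RingHom.ker (π W) = 𝔪.map (algebraMap A' Γ(X₀, W)))
  (h𝔪J : 𝔪 * J = ⊥) (hJ𝔪 : J ≤ 𝔪)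

include hΘred in
/-- The chart changes identify the closed fibres of the two chart lifts: `fibreRed r a ∘ Θ a = fibreRed r' a` (the hypothesis `hθ₁` of ★ (x)
`reading_transport`). [cite: Hartshorne2010, Thm. 10.2 (a) (proof), p. 81] -/
theorem fibreRed_chartChange (a : ι) {W : X₀.Opens} (h : W ≤ (V a).1) (pa : ∃ q : Γ(X₀, (V a).1), W = X₀.basicOpen q)
    (x : chartLift V r' a h) :
    fibreRed halg₀ V r π a h (Θ a W h pa x) = fibreRed halg₀ V r' π a h x := by
  change π W (reduction _ _ _ (Θ a W h pa x)) = π W (reduction _ _ _ x)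
  rw [hΘred]

include hΘred hΘnat hinter in
/-- **THE FACE READINGS DO NOT MOVE (f2).**  For both chart families flat: if `θ_δ = disc ψ' a b d` on the chart lift `L(r' a, res_{V a ∩ V b ∩ V d})`
(★ vocabulary `readingAut … = disc …`), then `θ_δ = disc χ a b d` on `L(r a, res_{V a ∩ V b ∩ V d})` for the transported gluings `χ` — the SAME
`δ ∈ Der_{A'}(B W₃, B W₃ ⊗ J)`, no coboundary: the transported discrepancy is the `Θ a`-conjugate of the old one (`chartChange_gluingOn` on the three
pairs of the face) and conjugate automorphisms of flat lifts with identified closed fibres (`fibreRed_chartChange`) have the same reading, ★ (x)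
`reading_transport`. [cite: Hartshorne2010, Remark 10.2.2, p. 82] [cite: Hartshorne2010, Thm. 10.2 (a) (proof), p. 81]
[cite: Oort1971, Lemma (2.2.4) (p. 274)] -/
theorem readingAut_eq_disc_of_chartChanges [∀ a, Module.Flat A' (P a)] [∀ a, Module.Flat A' (P' a)] (a b d : ι)
    {δ : Derivation A' (B ((V a).1 ⊓ (V b).1 ⊓ (V d).1)) (B ((V a).1 ⊓ (V b).1 ⊓ (V d).1) ⊗[A'] ↥J)}
    (hδ : readingAut halg₀ hJ V r' hr' hkr' 𝔪 π hπ h𝔪J hJ𝔪 a (inf_le_left.trans inf_le_left : (V a).1 ⊓ (V b).1 ⊓ (V d).1 ≤ (V a).1)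
      ⟨_, inf₃_eq_basicOpen₁ V c hc a b d⟩ δ = disc halg₀ hJ V c hc r' hr' hkr' ψ' hψ' a b d) :
    readingAut halg₀ hJ V r hr hkr 𝔪 π hπ h𝔪J hJ𝔪 a (inf_le_left.trans inf_le_left : (V a).1 ⊓ (V b).1 ⊓ (V d).1 ≤ (V a).1)
      ⟨_, inf₃_eq_basicOpen₁ V c hc a b d⟩ δ =
      disc halg₀ hJ V c hc r hr hkr χ (transport_reduction halg₀ V c hc r r' Θ hΘred ψ' hψ' χ hinter) a b d := by
  haveI := CanonicalLiftQuot.flat (r a) (AtlasQuot.res (inf_le_left.trans inf_le_left : (V a).1 ⊓ (V b).1 ⊓ (V d).1 ≤ (V a).1))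
  haveI := CanonicalLiftQuot.flat (r' a) (AtlasQuot.res (inf_le_left.trans inf_le_left : (V a).1 ⊓ (V b).1 ⊓ (V d).1 ≤ (V a).1))
  have hδ₀ := hδ
  rw [AtlasQuot.disc] at hδ₀
  rw [AtlasQuot.disc]
  exact reading_transport 𝔪 J h𝔪J hJ𝔪
    (Θ a _ (inf_le_left.trans inf_le_left) ⟨_, inf₃_eq_basicOpen₁ V c hc a b d⟩)
    (Θ b _ (inf_le_left.trans inf_le_right) ⟨_, inf₃_eq_basicOpen₂ V c hc a b d⟩)
    (Θ d _ inf_le_right ⟨_, inf₃_eq_basicOpen₃ V c hc a b d⟩)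
    (fibreRed halg₀ V r' π a _) (fibreRed_surjective halg₀ hJ V r' hr' hkr' 𝔪 π hπ a _ ⟨_, inf₃_eq_basicOpen₁ V c hc a b d⟩)
    (ker_fibreRed halg₀ hJ V r' hr' hkr' 𝔪 π hπ hJ𝔪 a _ ⟨_, inf₃_eq_basicOpen₁ V c hc a b d⟩)
    (fibreRed halg₀ V r π a _) (fibreRed_surjective halg₀ hJ V r hr hkr 𝔪 π hπ a _ ⟨_, inf₃_eq_basicOpen₁ V c hc a b d⟩)
    (ker_fibreRed halg₀ hJ V r hr hkr 𝔪 π hπ hJ𝔪 a _ ⟨_, inf₃_eq_basicOpen₁ V c hc a b d⟩)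
    (fibreRed_chartChange halg₀ V r r' Θ hΘred π a _ _)
    (chartChange_gluingOn J halg₀ hJ V c hc r hr hkr r' hr' hkr' Θ hΘred hΘnat ψ' hψ' χ hinter a b _ _ _ _ _)
    (chartChange_gluingOn J halg₀ hJ V c hc r hr hkr r' hr' hkr' Θ hΘred hΘnat ψ' hψ' χ hinter b d _ _ _ _ _)
    (chartChange_gluingOn J halg₀ hJ V c hc r hr hkr r' hr' hkr' Θ hΘred hΘnat ψ' hψ' χ hinter a d _ _ _ _ _) hδ₀

end Transport

include hc hr' hkr' in
/-- **(f1) + (f2) PACKAGED.**  For the second charts formally smooth and both chart families flat: every gluing system `ψ'` of the second charts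
transports to a reduction-compatible gluing system `χ` of the FIRST charts with THE SAME face readings — whenever `θ_δ = disc ψ' a b d` on the
second chart, `θ_δ = disc χ a b d` on the first (`exists_chartChanges`, `exists_transportedGluings`, `readingAut_eq_disc_of_chartChanges`).
[cite: Oort1971, Lemma (2.2.4) (p. 274)] [cite: Hartshorne2010, Remark 10.2.2, p. 82] [cite: Hartshorne2010, Thm. 10.2 (a) (proof), p. 81] -/
theorem exists_gluings_readingAut_eq_disc [∀ a, Algebra.FormallySmooth A' (P' a)] [∀ a, Module.Flat A' (P a)] [∀ a, Module.Flat A' (P' a)]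
    (ψ' : (a b : ι) → chartLift V r' a (inf_le_left : (V a).1 ⊓ (V b).1 ≤ (V a).1) ≃ₐ[A']
      chartLift V r' b (inf_le_right : (V a).1 ⊓ (V b).1 ≤ (V b).1))
    (hψ' : ∀ a b x, reduction (r' b) (AtlasQuot.res (inf_le_right : (V a).1 ⊓ (V b).1 ≤ (V b).1)) (halg₀ _ _ _) (ψ' a b x) =
      reduction (r' a) (AtlasQuot.res (inf_le_left : (V a).1 ⊓ (V b).1 ≤ (V a).1)) (halg₀ _ _ _) x)
    (𝔪 : Ideal A') {B : X₀.Opens → Type u} [∀ W, CommRing (B W)] [∀ W, Algebra A' (B W)] (π : (W : X₀.Opens) → Γ(X₀, W) →ₐ[A'] B W)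
    (hπ : ∀ (a : ι) (W : X₀.Opens), W ≤ (V a).1 → (∃ q : Γ(X₀, (V a).1), W = X₀.basicOpen q) →
      Function.Surjective (π W) ∧ RingHom.ker (π W) = 𝔪.map (algebraMap A' Γ(X₀, W)))
    (h𝔪J : 𝔪 * J = ⊥) (hJ𝔪 : J ≤ 𝔪) :
    ∃ (χ : (a b : ι) → chartLift V r a (inf_le_left : (V a).1 ⊓ (V b).1 ≤ (V a).1) ≃ₐ[A']
        chartLift V r b (inf_le_right : (V a).1 ⊓ (V b).1 ≤ (V b).1))
      (hχ : ∀ a b x, reduction (r b) (AtlasQuot.res (inf_le_right : (V a).1 ⊓ (V b).1 ≤ (V b).1)) (halg₀ _ _ _) (χ a b x) =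
        reduction (r a) (AtlasQuot.res (inf_le_left : (V a).1 ⊓ (V b).1 ≤ (V a).1)) (halg₀ _ _ _) x),
      ∀ (a b d : ι) (δ : Derivation A' (B ((V a).1 ⊓ (V b).1 ⊓ (V d).1)) (B ((V a).1 ⊓ (V b).1 ⊓ (V d).1) ⊗[A'] ↥J)),
        readingAut halg₀ hJ V r' hr' hkr' 𝔪 π hπ h𝔪J hJ𝔪 a (inf_le_left.trans inf_le_left : (V a).1 ⊓ (V b).1 ⊓ (V d).1 ≤ (V a).1)
            ⟨_, inf₃_eq_basicOpen₁ V c hc a b d⟩ δ = disc halg₀ hJ V c hc r' hr' hkr' ψ' hψ' a b d →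
          readingAut halg₀ hJ V r hr hkr 𝔪 π hπ h𝔪J hJ𝔪 a (inf_le_left.trans inf_le_left : (V a).1 ⊓ (V b).1 ⊓ (V d).1 ≤ (V a).1)
            ⟨_, inf₃_eq_basicOpen₁ V c hc a b d⟩ δ = disc halg₀ hJ V c hc r hr hkr χ hχ a b d := by
  obtain ⟨Θ, hΘred, hΘnat⟩ := exists_chartChanges J halg₀ hJ V c hc r hr hkr r' hr' hkr'
  obtain ⟨χ, hinter⟩ := exists_transportedGluings V c hc r r' Θ ψ'
  exact ⟨χ, transport_reduction halg₀ V c hc r r' Θ hΘred ψ' hψ' χ hinter, fun a b d δ hδ =>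
    readingAut_eq_disc_of_chartChanges J halg₀ hJ V c hc r hr hkr r' hr' hkr' Θ hΘred hΘnat ψ' hψ' χ hinter 𝔪 π hπ h𝔪J hJ𝔪
      a b d hδ⟩

/-! ## §4 (f3) The κ-class on a fixed cover does not depend on the chart lifts, the gluings or the readings -/

section KappaSide

variable {κ : Type u} [Field κ] [Algebra A' κ] (hκ : Function.Surjective (algebraMap A' κ))
  {X : Over (Spec (CommRingCat.of κ))} [instΓ : ∀ W : X.left.Opens, Algebra A' Γ(X.left, W)]
  (halg : ∀ (W : X.left.Opens) (a : A'), algebraMap A' Γ(X.left, W) a = (constToPresheaf X).app (op W) (algebraMap A' κ a))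
  (φ : ↥J ≃ₗ[A'] κ)
  -- the κ-side closed-fibre layer of ★ (vii-b): the honest closed fibre `X` over the residue field, lying over `X₀` by `i`
  (i : X.left ⟶ X₀) (hiV : ∀ a, IsAffineOpen (i ⁻¹ᵁ (V a).1))
  (𝔪 : Ideal A') (h𝔪J : 𝔪 * J = ⊥) (hJ𝔪 : J ≤ 𝔪)
  (π : (W : X₀.Opens) → Γ(X₀, W) →ₐ[A'] Γ(X.left, i ⁻¹ᵁ W))
  (hπ : ∀ (a : ι) (W : X₀.Opens), W ≤ (V a).1 → (∃ q : Γ(X₀, (V a).1), W = X₀.basicOpen q) →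
    Function.Surjective (π W) ∧ RingHom.ker (π W) = 𝔪.map (algebraMap A' Γ(X₀, W)))

include hκ halg hc hiV hr' hkr' in
/-- **THE κ-CLASS ON A FIXED COVER DOES NOT DEPEND ON THE CHART LIFTS, THE GLUINGS OR THE READINGS (f3)** ([Oort1971] §2.2: `D(X′; R → R′)`
«does not depend on the choices made»; [Hartshorne2010] Cor. 10.3 (a) «just one obstruction»).  On one principal affine cover `(V, c)` of `X₀` with one
closed-fibre layer
`π` on the κ-side (`X`, `i`, `hπnat`, `φ : J ≅ κ`): two data — formally smooth flat charts `(P, r)` ∕ `(P', r')`, reduction-compatible gluings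
`ψ` ∕ `ψ'`, face readings `δ` ∕ `δ'` (`readingAut … = disc …`), closed Čech 2-cochains `o` ∕ `o'` of `𝒯_{X/κ}` on `i⁻¹𝒱` representing them — have
`[o'] = [o]` in `Ȟ²(i⁻¹𝒱; 𝒯_{X/κ})`: the second data's readings `δ'` ARE face readings of the transported gluings `χ` of the FIRST charts
(`exists_gluings_readingAut_eq_disc`), and the class does not depend on the gluings (★ (vii-b) C `cechMH2_mk_eq_of_gluings`, `ψ` vs `χ`).
[cite: Oort1971, §2.2 (pp. 277–280)] [cite: Oort1971, Lemma (2.2.4) (p. 274)] [cite: Hartshorne2010, Thm. 10.2 (a) (proof), p. 81]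
[cite: Hartshorne2010, Cor. 10.3 (a), p. 82] -/
theorem cechMH2_mk_eq_of_chartChange [∀ a, Module.Flat A' (P a)] [∀ a, Algebra.FormallySmooth A' (P' a)] [∀ a, Module.Flat A' (P' a)]
    (hπnat : ∀ ⦃W W' : X₀.Opens⦄ (h : W' ≤ W) (x : Γ(X₀, W)),
      X.left.presheaf.map (homOfLE (i.preimage_mono h)).op (π W x) = π W' (AtlasQuot.res h x))
    -- gluings of the FIRST charts and of the SECOND charts
    (ψ : (a b : ι) → chartLift V r a (inf_le_left : (V a).1 ⊓ (V b).1 ≤ (V a).1) ≃ₐ[A']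
      chartLift V r b (inf_le_right : (V a).1 ⊓ (V b).1 ≤ (V b).1))
    (hψ : ∀ a b x, reduction (r b) (AtlasQuot.res (inf_le_right : (V a).1 ⊓ (V b).1 ≤ (V b).1)) (halg₀ _ _ _) (ψ a b x) =
      reduction (r a) (AtlasQuot.res (inf_le_left : (V a).1 ⊓ (V b).1 ≤ (V a).1)) (halg₀ _ _ _) x)
    (ψ' : (a b : ι) → chartLift V r' a (inf_le_left : (V a).1 ⊓ (V b).1 ≤ (V a).1) ≃ₐ[A']
      chartLift V r' b (inf_le_right : (V a).1 ⊓ (V b).1 ≤ (V b).1))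
    (hψ' : ∀ a b x, reduction (r' b) (AtlasQuot.res (inf_le_right : (V a).1 ⊓ (V b).1 ≤ (V b).1)) (halg₀ _ _ _) (ψ' a b x) =
      reduction (r' a) (AtlasQuot.res (inf_le_left : (V a).1 ⊓ (V b).1 ≤ (V a).1)) (halg₀ _ _ _) x)
    -- their face readings
    (δ δ' : (a b d : ι) → Derivation A' Γ(X.left, i ⁻¹ᵁ ((V a).1 ⊓ (V b).1 ⊓ (V d).1))
      (Γ(X.left, i ⁻¹ᵁ ((V a).1 ⊓ (V b).1 ⊓ (V d).1)) ⊗[A'] ↥J))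
    (hδ : ∀ a b d, readingAut halg₀ hJ V r hr hkr 𝔪 π hπ h𝔪J hJ𝔪 a (inf_le_left.trans inf_le_left : (V a).1 ⊓ (V b).1 ⊓ (V d).1 ≤ (V a).1)
      ⟨_, inf₃_eq_basicOpen₁ V c hc a b d⟩ (δ a b d) = disc halg₀ hJ V c hc r hr hkr ψ hψ a b d)
    (hδ' : ∀ a b d, readingAut halg₀ hJ V r' hr' hkr' 𝔪 π hπ h𝔪J hJ𝔪 a (inf_le_left.trans inf_le_left : (V a).1 ⊓ (V b).1 ⊓ (V d).1 ≤ (V a).1)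
      ⟨_, inf₃_eq_basicOpen₁ V c hc a b d⟩ (δ' a b d) = disc halg₀ hJ V c hc r' hr' hkr' ψ' hψ' a b d)
    -- and cocycles representing them
    {o o' : CechMC2 X.hom (tangentSheaf X) (fun a => i ⁻¹ᵁ (V a).1)}
    (ho : ∀ (a b d : ι) (x : Γ(X.left, i ⁻¹ᵁ (V a).1 ⊓ i ⁻¹ᵁ (V b).1 ⊓ i ⁻¹ᵁ (V d).1)),
      δ a b d x = (show Γ(X.left, i ⁻¹ᵁ (V a).1 ⊓ i ⁻¹ᵁ (V b).1 ⊓ i ⁻¹ᵁ (V d).1) from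
        appLE (o a b d) (𝟙 _) (dSection X _ x)) ⊗ₜ φ.symm 1)
    (ho' : ∀ (a b d : ι) (x : Γ(X.left, i ⁻¹ᵁ (V a).1 ⊓ i ⁻¹ᵁ (V b).1 ⊓ i ⁻¹ᵁ (V d).1)),
      δ' a b d x = (show Γ(X.left, i ⁻¹ᵁ (V a).1 ⊓ i ⁻¹ᵁ (V b).1 ⊓ i ⁻¹ᵁ (V d).1) from
        appLE (o' a b d) (𝟙 _) (dSection X _ x)) ⊗ₜ φ.symm 1)
    (ho₂ : o ∈ cechMZ2 X.hom (tangentSheaf X) (fun a => i ⁻¹ᵁ (V a).1))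
    (ho₂' : o' ∈ cechMZ2 X.hom (tangentSheaf X) (fun a => i ⁻¹ᵁ (V a).1)) :
    CechMH2.mk X.hom (tangentSheaf X) (fun a => i ⁻¹ᵁ (V a).1) ⟨o', ho₂'⟩ =
      CechMH2.mk X.hom (tangentSheaf X) (fun a => i ⁻¹ᵁ (V a).1) ⟨o, ho₂⟩ := by
  obtain ⟨χ, hχ, hread⟩ := exists_gluings_readingAut_eq_disc J halg₀ hJ V c hc r hr hkr r' hr' hkr' ψ' hψ' 𝔪 π hπ h𝔪J hJ𝔪
  exact cechMH2_mk_eq_of_gluings hκ halg J φ halg₀ hJ V c hc r hr hkr i hiV 𝔪 h𝔪J hJ𝔪 π hπ hπnat ψ χ hψ hχ δ δ' hδ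
    (fun a b d => hread a b d (δ' a b d) (hδ' a b d)) ho ho' ho₂ ho₂'

end KappaSide

end Literature.AlgebraicGeometry.Deformation.AtlasChartChangeQuot

end
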